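import Summits.BirchSwinnertonDyer.BirchSwinnertonDyer.Theses.ShadowIsolation
import Summits.BirchSwinnertonDyer.BirchSwinnertonDyer.Theses.SelmerRank
import Literature.NumberTheory.EllipticCurves.NonEisensteinPrimeOfSurjective
import Literature.NumberTheory.EllipticCurves.IwasawaLeadingTermProofs
import Literature.NumberTheory.EllipticCurves.LeadingTerm
import Literature.NumberTheory.EllipticCurves.PAdicBSD

/-!
# BirchSwinnertonDyer / ShadowIsolation — crux `ShaCotorsionReducible` (stmt-BirchSwinnertonDyer-15277):
# reductions, dictionary and known regimes (line `registered` = `Cruxes/ShaCotorsionReducible/Lines/birth.lean`)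

The crux `R = ShaCotorsionReducible` of route `ShadowIsolation` (the RESIDUAL EISENSTEIN SECTOR): for
`W/ℚ` globally minimal elliptic and a prime `p ≥ 5` of good ordinary reduction at which `E[p]` is
REDUCIBLE (`E` admits a rational `p`-isogeny), `corank_{ℤ_p} Ш(E/ℚ)[p^∞] = 0` (`W.shaCorank p = 0`).
This file lands, sorry-free and with axioms `propext` / `Classical.choice` / `Quot.sound` only, the
bookkeeping every attempt on the crux uses, so that later seats import it instead of re-deriving it:

* `shaCotorsionReducible_of_bounds` — the COMPOSITION CERTIFICATE of line `registered`: the two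
  registered stub signatures (UB: sector ⇒ `corank Sel_{p^∞} ≤ r_an`; LB: sector ⇒ `r_an ≤ rank`)
  imply the crux BY NAME, through Greenberg's proved corank identity
  `corank Sel_{p^∞} = rank + corank Ш[p^∞]` (`WeierstrassCurve.selmerCorank_eq_mordellWeilRank_add_holds`).
* `shaCotorsionReducible_iff_selmerCorank_le` / `shaCotorsionReducible_iff_finite` — the DICTIONARY:
  the crux is literally "sector ⇒ `corank Sel_{p^∞}(E/ℚ) ≤ rank E(ℚ)`" and literally
  "sector ⇒ `Ш(E/ℚ)[p^∞]` finite" (`finite_primaryComponent_sha_iff_shaCorank_eq_zero`).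
* `shaCotorsionReducible_of_selmerRankShaPFinite` — DOMINATION: the crux is the Eisenstein-sector
  restriction of crux `SelmerRank.SelmerRankShaPFinite` (stmt-BirchSwinnertonDyer-0132, `∀ W p,
  Finite Ш[p^∞]`).
* `not_hasSurjectiveModNGaloisRep_of_not_hasIrreducibleModPGaloisRep` — the sector lies in the
  small-image sector (reducible ⇒ not surjective; contrapositive of the proved
  `hasIrreducibleModPGaloisRep_of_hasSurjectiveModNGaloisRep`), whence
  `selmerUB_reducible_of_selmerRankSmallImage` (stub UB is implied by the route's own item
  `SelmerRankSmallImage`, stmt-BirchSwinnertonDyer-14418) and the pair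
  `shaCotorsionReducible_of_selmerRankSmallImage_of_rankLB` /
  `rankLB_reducible_of_selmerRankSmallImage_of_shaCotorsionReducible`: MODULO item 14418 the crux is
  EQUIVALENT to stub LB, which is therefore the load-bearing stub of the line.
* KNOWN REGIMES (conditional on printed theorems vendored as named facts, D-0014):
  `shaCorank_eq_zero_of_analyticRank_le_one` (Gross–Zagier–Kolyvagin, `r_an ≤ 1`, every prime `p`,
  fact `rank_eq_analyticRank_of_analyticRank_le_one`) and `shaCorank_eq_zero_of_entireLFunction_one_ne_zero`
  (Kato, `L(E,1) ≠ 0`, every prime `p`, fact `kato_finite_of_L_one_ne_zero`), with the corresponding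
  sector statements `shaCotorsionReducible_regime_analyticRank_le_one` /
  `bounds_regime_analyticRank_le_one` (both stubs hold in the regime `r_an ≤ 1`).

Honesty note (numbers, not adjectives). Outside these regimes — i.e. once `min(corank Sel_{p^∞}, r_an) ≥ 2`
— both stubs and the crux are OPEN PROBLEMS: UB lacks `ord_{T=0} L_p(E,T) ≤ ord_{s=1} L(E,s)` (Kato's
Thm. 18.4 gives only `corank ≤ ord_{T=0} L_p`), LB lacks any construction of two independent rational
points (Heegner points are torsion once `r_an ≥ 2`), and no printed theorem separates `Ш_div` from
points at any prime. Nothing here claims otherwise; every theorem below is either unconditional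
bookkeeping or explicitly conditional on a named fact appearing as a hypothesis.
-/

-- D-0017: single-problem summit, so `Summit.BirchSwinnertonDyer.BirchSwinnertonDyer.…` repeats a
-- namespace BY DESIGN.
set_option linter.dupNamespace false

namespace Summit.BirchSwinnertonDyer.BirchSwinnertonDyer.Theorems

open Literature.NumberTheory.EllipticCurves
open Summit.BirchSwinnertonDyer.BirchSwinnertonDyer.Theses

/-! ## The composition certificate of line `registered` -/

/-- **Composition certificate (line `registered`).** The two registered stub signatures — UB:
on the Eisenstein sector `corank_{ℤ_p} Sel_{p^∞}(E/ℚ) ≤ ord_{s=1} L(E,s)`, LB: on the sector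
`ord_{s=1} L(E,s) ≤ rank E(ℚ)` — imply the crux `ShaCotorsionReducible` by name: Greenberg's corank
identity `corank Sel_{p^∞} = rank + corank Ш[p^∞]` (LNM 1716, §1, pp. 54–57; proved in tree) and
`rank + corank Ш ≤ r_an ≤ rank` force `corank Ш[p^∞] = 0`. [cite: Greenberg1999LNM, §1 pp. 54–57] -/
theorem shaCotorsionReducible_of_bounds
    (hUB : ∀ (W : WeierstrassCurve ℚ) [W.IsElliptic] [W.IsGloballyMinimal] (p : ℕ) [Fact p.Prime],
      5 ≤ p → W.HasGoodReductionAtPrime p → ¬ (p : ℤ) ∣ W.frobeniusTrace p →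
      ¬ W.HasIrreducibleModPGaloisRep p → W.selmerCorank p ≤ W.analyticRank)
    (hLB : ∀ (W : WeierstrassCurve ℚ) [W.IsElliptic] [W.IsGloballyMinimal] (p : ℕ) [Fact p.Prime],
      5 ≤ p → W.HasGoodReductionAtPrime p → ¬ (p : ℤ) ∣ W.frobeniusTrace p →
      ¬ W.HasIrreducibleModPGaloisRep p → W.analyticRank ≤ W.mordellWeilRank) :
    ShadowIsolation.ShaCotorsionReducible := by
  intro W _ _ p _ h5 hgood hord hred
  have hId : W.selmerCorank p = W.mordellWeilRank + W.shaCorank p :=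
    W.selmerCorank_eq_mordellWeilRank_add_holds p
  have hub : W.selmerCorank p ≤ W.analyticRank := hUB W p h5 hgood hord hred
  have hlb : W.analyticRank ≤ W.mordellWeilRank := hLB W p h5 hgood hord hred
  omega

/-! ## Dictionary -/

/-- **Dictionary, corank form.** The crux is literally the statement "on the Eisenstein sector,
`corank_{ℤ_p} Sel_{p^∞}(E/ℚ) ≤ rank E(ℚ)`": by Greenberg's identity
`corank Sel_{p^∞} = rank + corank Ш[p^∞]` (LNM 1716, §1), `corank Ш[p^∞] = 0 ↔ corank Sel ≤ rank`.
[cite: Greenberg1999LNM, §1 pp. 54–57] -/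
theorem shaCotorsionReducible_iff_selmerCorank_le :
    ShadowIsolation.ShaCotorsionReducible ↔
      ∀ (W : WeierstrassCurve ℚ) [W.IsElliptic] [W.IsGloballyMinimal] (p : ℕ) [Fact p.Prime],
        5 ≤ p → W.HasGoodReductionAtPrime p → ¬ (p : ℤ) ∣ W.frobeniusTrace p →
        ¬ W.HasIrreducibleModPGaloisRep p → W.selmerCorank p ≤ W.mordellWeilRank := by
  constructor
  · intro h W _ _ p _ h5 hgood hord hred
    have hId : W.selmerCorank p = W.mordellWeilRank + W.shaCorank p :=
      W.selmerCorank_eq_mordellWeilRank_add_holds p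
    have h0 : W.shaCorank p = 0 := h W p h5 hgood hord hred
    omega
  · intro h W _ _ p _ h5 hgood hord hred
    have hId : W.selmerCorank p = W.mordellWeilRank + W.shaCorank p :=
      W.selmerCorank_eq_mordellWeilRank_add_holds p
    have hle : W.selmerCorank p ≤ W.mordellWeilRank := h W p h5 hgood hord hred
    omega

/-- **Dictionary, finiteness form.** The crux is literally the statement "on the Eisenstein sector,
`Ш(E/ℚ)[p^∞]` is finite": `Ш[p^∞]` is `p`-primary with finite `p`-torsion (weak Mordell–Weil), so it
is finite iff its `ℤ_p`-corank vanishes (tree theorem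
`finite_primaryComponent_sha_iff_shaCorank_eq_zero`, Greenberg 1999, §1). [cite: Greenberg1999LNM, §1 pp. 54–57] -/
theorem shaCotorsionReducible_iff_finite :
    ShadowIsolation.ShaCotorsionReducible ↔
      ∀ (W : WeierstrassCurve ℚ) [W.IsElliptic] [W.IsGloballyMinimal] (p : ℕ) [Fact p.Prime],
        5 ≤ p → W.HasGoodReductionAtPrime p → ¬ (p : ℤ) ∣ W.frobeniusTrace p →
        ¬ W.HasIrreducibleModPGaloisRep p → Finite (AddCommGroup.primaryComponent W.sha p) := by
  constructor
  · intro h W _ _ p _ h5 hgood hord hred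
    exact (finite_primaryComponent_sha_iff_shaCorank_eq_zero W p).2 (h W p h5 hgood hord hred)
  · intro h W _ _ p _ h5 hgood hord hred
    exact (finite_primaryComponent_sha_iff_shaCorank_eq_zero W p).1 (h W p h5 hgood hord hred)

/-! ## Domination by crux `SelmerRankShaPFinite` (stmt-BirchSwinnertonDyer-0132) -/

/-- **Domination.** The crux is the Eisenstein-sector restriction of route `SelmerRank`'s crux
`SelmerRankShaPFinite` (stmt-BirchSwinnertonDyer-0132: `Ш(E/ℚ)[p^∞]` is finite for every elliptic
`W/ℚ` and every prime `p`): a finite `p`-primary group has `ℤ_p`-corank `0`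
(`finite_primaryComponent_sha_iff_shaCorank_eq_zero`, Greenberg 1999, §1). [cite: Greenberg1999LNM, §1 pp. 54–57] -/
theorem shaCotorsionReducible_of_selmerRankShaPFinite : Summit.BirchSwinnertonDyer.BirchSwinnertonDyer.Theses.SelmerRank.SelmerRankShaPFinite → Summit.BirchSwinnertonDyer.BirchSwinnertonDyer.Theses.ShadowIsolation.ShaCotorsionReducible := by
  intro h W _ _ p _ _ _ _ _
  exact (finite_primaryComponent_sha_iff_shaCorank_eq_zero W p).1 (h W p)

/-! ## The sector lies in the small-image sector; the crux modulo `SelmerRankSmallImage` -/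

/-- **Reducible ⇒ not surjective.** If `E[p]` is a reducible `Γ_ℚ`-module then
`ρ̄_{E,p} : Γ_ℚ → Aut(E[p])` is not surjective — the contrapositive of the tree theorem
`hasIrreducibleModPGaloisRep_of_hasSurjectiveModNGaloisRep` (a surjective image moves every line;
Serre 1972, §4). So the Eisenstein sector of this crux is contained in the small-image sector of
the route item `SelmerRankSmallImage` (stmt-BirchSwinnertonDyer-14418). [cite: Serre1972, §4] -/
theorem not_hasSurjectiveModNGaloisRep_of_not_hasIrreducibleModPGaloisRep
    (W : WeierstrassCurve ℚ) [W.IsElliptic] (p : ℕ) [Fact p.Prime]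
    (hred : ¬ W.HasIrreducibleModPGaloisRep p) : ¬ W.HasSurjectiveModNGaloisRep p := by
  intro hsurj
  haveI : NeZero (p : ℚ) := ⟨Nat.cast_ne_zero.mpr (Fact.out : p.Prime).ne_zero⟩
  exact hred (hasIrreducibleModPGaloisRep_of_hasSurjectiveModNGaloisRep W p hsurj)

/-- **Stub UB from item 14418.** The route item `SelmerRankSmallImage` (stmt-BirchSwinnertonDyer-14418:
at a good ordinary `p ≥ 5` with `ρ̄_{E,p}` NOT surjective, `corank Sel_{p^∞} = r_an`) implies the
registered stub `stub_selmerUB_reducible` of line `registered` (sector ⇒ `corank Sel_{p^∞} ≤ r_an`),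
since reducible ⇒ not surjective. (Item 14418 is itself open from `min(corank, r_an) ≥ 2`; this is a
reduction, not a discharge.) [cite: Greenberg1999LNM, §1 pp. 54–57] -/
theorem selmerUB_reducible_of_selmerRankSmallImage (hSI : ShadowIsolation.SelmerRankSmallImage) :
    ∀ (W : WeierstrassCurve ℚ) [W.IsElliptic] [W.IsGloballyMinimal] (p : ℕ) [Fact p.Prime],
      5 ≤ p → W.HasGoodReductionAtPrime p → ¬ (p : ℤ) ∣ W.frobeniusTrace p →
      ¬ W.HasIrreducibleModPGaloisRep p → W.selmerCorank p ≤ W.analyticRank := by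
  intro W _ _ p _ h5 hgood hord hred
  exact (hSI W p h5 hgood hord
    (not_hasSurjectiveModNGaloisRep_of_not_hasIrreducibleModPGaloisRep W p hred)).le

/-- **Crux from item 14418 and stub LB.** `SelmerRankSmallImage` (stmt-BirchSwinnertonDyer-14418)
and the registered stub `stub_rankLB_reducible` (sector ⇒ `r_an ≤ rank`) imply the crux: on the
sector `corank Sel_{p^∞} = r_an ≤ rank`, and the dictionary `shaCotorsionReducible_iff_selmerCorank_le`
concludes. [cite: Greenberg1999LNM, §1 pp. 54–57] -/
theorem shaCotorsionReducible_of_selmerRankSmallImage_of_rankLB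
    (hSI : ShadowIsolation.SelmerRankSmallImage)
    (hLB : ∀ (W : WeierstrassCurve ℚ) [W.IsElliptic] [W.IsGloballyMinimal] (p : ℕ) [Fact p.Prime],
      5 ≤ p → W.HasGoodReductionAtPrime p → ¬ (p : ℤ) ∣ W.frobeniusTrace p →
      ¬ W.HasIrreducibleModPGaloisRep p → W.analyticRank ≤ W.mordellWeilRank) :
    ShadowIsolation.ShaCotorsionReducible :=
  shaCotorsionReducible_of_bounds (selmerUB_reducible_of_selmerRankSmallImage hSI) hLB

/-- **Stub LB from item 14418 and the crux** (converse direction: modulo `SelmerRankSmallImage`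
the crux is EQUIVALENT to stub LB, which is therefore the load-bearing stub of line `registered`).
On the sector `corank Sel_{p^∞} = r_an` (item 14418) and `corank Sel_{p^∞} ≤ rank` (the crux, corank
form), hence `r_an ≤ rank`. [cite: Greenberg1999LNM, §1 pp. 54–57] -/
theorem rankLB_reducible_of_selmerRankSmallImage_of_shaCotorsionReducible
    (hSI : ShadowIsolation.SelmerRankSmallImage) (hR : ShadowIsolation.ShaCotorsionReducible) :
    ∀ (W : WeierstrassCurve ℚ) [W.IsElliptic] [W.IsGloballyMinimal] (p : ℕ) [Fact p.Prime],
      5 ≤ p → W.HasGoodReductionAtPrime p → ¬ (p : ℤ) ∣ W.frobeniusTrace p →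
      ¬ W.HasIrreducibleModPGaloisRep p → W.analyticRank ≤ W.mordellWeilRank := by
  intro W _ _ p _ h5 hgood hord hred
  have heq : W.selmerCorank p = W.analyticRank :=
    hSI W p h5 hgood hord (not_hasSurjectiveModNGaloisRep_of_not_hasIrreducibleModPGaloisRep W p hred)
  have hle : W.selmerCorank p ≤ W.mordellWeilRank :=
    shaCotorsionReducible_iff_selmerCorank_le.1 hR W p h5 hgood hord hred
  omega

/-! ## Known regimes (conditional on printed theorems vendored as named facts) -/

/-- **Regime `r_an ≤ 1` (Gross–Zagier–Kolyvagin), every prime `p`.** Granting the named fact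
`rank_eq_analyticRank_of_analyticRank_le_one` (Darmon 2004, Thm. 3.22: `ord_{s=1} L(E,s) ≤ 1 ⇒
rank E(ℚ) = ord ∧ Ш(E/ℚ)` finite), every elliptic `W/ℚ` with `W.analyticRank ≤ 1` has
`corank_{ℤ_p} Ш(E/ℚ)[p^∞] = 0` at every prime (a finite `Ш` has finite `p`-primary part, of corank `0`:
`WeierstrassCurve.shaCorank_eq_zero_of_finite`). No sector hypothesis is used. [cite: Darmon2004, Thm. 3.22] -/
theorem shaCorank_eq_zero_of_analyticRank_le_one (hGZK : rank_eq_analyticRank_of_analyticRank_le_one)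
    (W : WeierstrassCurve ℚ) [W.IsElliptic] (p : ℕ) [Fact p.Prime] (h : W.analyticRank ≤ 1) :
    W.shaCorank p = 0 := by
  haveI : Finite W.sha := (hGZK W h).2
  exact W.shaCorank_eq_zero_of_finite p

/-- **Both stubs in the regime `r_an ≤ 1` (Gross–Zagier–Kolyvagin).** Granting
`rank_eq_analyticRank_of_analyticRank_le_one`, an elliptic `W/ℚ` with `W.analyticRank ≤ 1` satisfies
`corank Sel_{p^∞} ≤ r_an` AND `r_an ≤ rank` at every prime `p` (rank `= r_an`, `Ш` finite, Greenberg's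
identity): the two registered stubs of line `registered` restricted to this regime, with no sector
hypothesis. [cite: Darmon2004, Thm. 3.22] [cite: Greenberg1999LNM, §1 pp. 54–57] -/
theorem bounds_regime_analyticRank_le_one (hGZK : rank_eq_analyticRank_of_analyticRank_le_one)
    (W : WeierstrassCurve ℚ) [W.IsElliptic] (p : ℕ) [Fact p.Prime] (h : W.analyticRank ≤ 1) :
    W.selmerCorank p ≤ W.analyticRank ∧ W.analyticRank ≤ W.mordellWeilRank := by
  obtain ⟨hrank, hfin⟩ := hGZK W h
  haveI : Finite W.sha := hfin
  have hId : W.selmerCorank p = W.mordellWeilRank + W.shaCorank p :=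
    W.selmerCorank_eq_mordellWeilRank_add_holds p
  have h0 : W.shaCorank p = 0 := W.shaCorank_eq_zero_of_finite p
  constructor <;> omega

/-- **The crux in the regime `r_an ≤ 1`.** Granting `rank_eq_analyticRank_of_analyticRank_le_one`
(Gross–Zagier–Kolyvagin), the conclusion of `ShaCotorsionReducible` holds for every `W` of analytic
rank `≤ 1` on the Eisenstein sector (indeed at every prime, `shaCorank_eq_zero_of_analyticRank_le_one`);
what remains open is exactly the sub-sector `r_an ≥ 2`. [cite: Darmon2004, Thm. 3.22] -/
theorem shaCotorsionReducible_regime_analyticRank_le_one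
    (hGZK : rank_eq_analyticRank_of_analyticRank_le_one) :
    ∀ (W : WeierstrassCurve ℚ) [W.IsElliptic] [W.IsGloballyMinimal] (p : ℕ) [Fact p.Prime],
      5 ≤ p → W.HasGoodReductionAtPrime p → ¬ (p : ℤ) ∣ W.frobeniusTrace p →
      ¬ W.HasIrreducibleModPGaloisRep p → W.analyticRank ≤ 1 → W.shaCorank p = 0 :=
  fun W _ _ p _ _ _ _ _ h ↦ shaCorank_eq_zero_of_analyticRank_le_one hGZK W p h

/-- **Regime `L(E,1) ≠ 0` (Kato), at the prime `p` itself.** Granting Kato's finiteness theorem at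
`(W, p)` (named fact `kato_finite_of_L_one_ne_zero W p`, Astérisque 295, Cor. 14.3: `L(E,1) ≠ 0 ⇒
E(ℚ)`, `Ш(E/ℚ)[p^∞]` and `Sel_{p^∞}(E/ℚ)` finite — an Euler-system proof independent of Heegner
points and valid at Eisenstein primes), `L(E,1) ≠ 0` (the value at `s = 1` of the entire
continuation, `W.entireLFunction 1 ≠ 0`) gives `corank_{ℤ_p} Ш(E/ℚ)[p^∞] = 0`. [cite: Kato2004Asterisque, Cor. 14.3 (p. 235)] -/
theorem shaCorank_eq_zero_of_entireLFunction_one_ne_zero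
    (W : WeierstrassCurve ℚ) [W.IsElliptic] [W.IsGloballyMinimal] (p : ℕ) [Fact p.Prime]
    (hKato : kato_finite_of_L_one_ne_zero W p) (hL : W.entireLFunction 1 ≠ 0) :
    W.shaCorank p = 0 :=
  (finite_primaryComponent_sha_iff_shaCorank_eq_zero W p).1 (hKato hL).2.1

end Summit.BirchSwinnertonDyer.BirchSwinnertonDyer.Theorems
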